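import Literature.AlgebraicGeometry.Modules.UnitCocyclePullback
import HarnessLib

/-!
# `Ȟ¹(Spec R, 𝒪^×)` is trivial for a local ring `R`: every line bundle on a local scheme is trivial
# (a Čech cocycle one of whose charts is the whole space is a coboundary)

Layer `Literature/AlgebraicGeometry/Modules`, namespace `Literature.AlgebraicGeometry.Modules`.  THEOREMS ONLY (no
definition, no named fact, no instance).  In the tree's cocycle presentation of the Picard group (`Modules/UnitCocycle`:
point-indexed Čech `1`-cocycles of units `c = (U_x, g_{xy})`, `CechPic X = Ȟ¹(X, 𝒪_X^×)`; Hartshorne III Ex. 4.5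
«`Pic X ≅ H¹(X, 𝒪_X^*)`») we record:

* `UnitCocycle.equiv_one_of_top_le` — if some chart `U_{x₀}` is ALL of `X`, the cocycle is a coboundary: the `0`-cochain
  `λ_x := g_{x₀ x}` on `U_x` satisfies `g_{x₀ y} = g_{x₀ x} g_{x y}` (the cocycle identity), so `c ∼ 1`;
  `CechPic.mk_eq_one_of_top_le`;
* `CechPic.eq_one_of_isLocalRing` — for a LOCAL ring `R` every class of `Ȟ¹(Spec R, 𝒪^×)` is trivial: the chart at the
  closed point contains the closed point, hence is everything (Mathlib `IsLocalRing.closedPoint_mem_iff`: an open of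
  `Spec R` containing the closed point is `⊤`, every point specialising to it); `CechPic.pullback_eq_one_of_isLocalRing`
  (pull-back to a local scheme kills every class) — Hartshorne II Ex. 6.8 with II.6 «every invertible sheaf on the
  spectrum of a local ring is trivial» (a finitely generated projective module over a local ring is free).

Consumer (cell `hodgecm-mathlib`): restrictions of line bundles along `Spec ℂ[ε]`-valued points (`ℂ[ε]` is local).
Presearch: [corpus] Hartshorne II §6 p. 143 / III Ex. 4.5; Stacks 00NZ (Algebra, Lemma 10.78.5: a finite flat module over a
local ring is finite free) with 0B8I (More on Algebra, Lemma 15.119.2: invertible ⟺ finite locally free of rank 1) ⇒ «Pic of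
a local ring is trivial»; the cocycle-level phrasing is folklore.  Mathlib searched and used: `IsLocalRing.closedPoint`, `IsLocalRing.closedPoint_mem_iff`.

## References
* R. Hartshorne, *Algebraic Geometry*, GTM 52 (1977), II §6 (p. 143), II Ex. 6.8, III Ex. 4.5. [Hartshorne1977]
* The Stacks Project, Tag 00NZ (Algebra, Lemma 10.78.5) with Tag 0B8I (More on Algebra, Lemma 15.119.2). [StacksProject]
-/

noncomputable section

open CategoryTheory AlgebraicGeometry TopologicalSpace Opposite

universe u

namespace Literature.AlgebraicGeometry.Modules

variable {X : Scheme.{u}}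

/-- **A cocycle one of whose charts is the whole space is a coboundary**: if `⊤ ≤ U_{x₀}` then `c ∼ 1`, the
`0`-cochain being `λ_x = g_{x₀ x}` on `U_x` (cocycle identity `g_{x₀ y} = g_{x₀ x} g_{x y}`).
[cite: Hartshorne1977, III Ex. 4.5] -/
theorem UnitCocycle.equiv_one_of_top_le (c : UnitCocycle X) (x₀ : X) (h : ⊤ ≤ c.U x₀) :
    UnitCocycle.Equiv c (UnitCocycle.one X) :=
  ⟨{ W := c.U
     mem := c.mem
     le := fun _ ↦ le_rfl
     le' := fun _ ↦ le_top
     lam := fun x V hV ↦ c.g x₀ x V (le_top.trans h) hV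
     inv := fun x V hV ↦ c.g x x₀ V hV (le_top.trans h)
     map_lam := fun x V V' hV i ↦ c.map_g x₀ x (le_top.trans h) hV i
     lam_mul_inv := fun x V hV ↦ c.g_mul_symm x₀ x V (le_top.trans h) hV
     rel := fun x y V hx hy ↦ by
       change (1 : Γ(X, V)) * c.g x₀ y V _ hy = c.g x₀ x V _ hx * c.g x y V hx hy
       rw [one_mul, c.g_mul] }⟩

/-- In `Ȟ¹(X, 𝒪_X^×)`: a cocycle with a chart equal to `X` has trivial class. [cite: Hartshorne1977, III Ex. 4.5] -/
theorem CechPic.mk_eq_one_of_top_le (c : UnitCocycle X) (x₀ : X) (h : ⊤ ≤ c.U x₀) : CechPic.mk c = 1 := by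
  rw [← CechPic.mk_one]
  exact CechPic.sound (c.equiv_one_of_top_le x₀ h)

/-- **`Ȟ¹(Spec R, 𝒪^×) = 1` for a local ring `R`**: every Čech class of units on the spectrum of a local ring is
trivial (the chart at the closed point is an open containing the closed point, hence all of `Spec R`) — «every
invertible sheaf on a local scheme is trivial». [cite: Hartshorne1977, II §6 (p. 143) and III Ex. 4.5] [cite: StacksProject, Tag 00NZ (Algebra, Lemma 10.78.5) with Tag 0B8I (More on Algebra, Lemma 15.119.2)] -/
theorem CechPic.eq_one_of_isLocalRing {R : CommRingCat.{u}} [IsLocalRing R] (a : CechPic (Spec R)) : a = 1 := by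
  obtain ⟨c, rfl⟩ := CechPic.mk_surjective a
  refine CechPic.mk_eq_one_of_top_le c (IsLocalRing.closedPoint R) (le_of_eq ?_)
  exact ((IsLocalRing.closedPoint_mem_iff (c.U (IsLocalRing.closedPoint R))).1 (c.mem _)).symm

/-- Pull-back to the spectrum of a local ring kills every class of `Ȟ¹(–, 𝒪^×)` (restriction of a line bundle along an
`R`-valued point, `R` local, is trivial). [cite: Hartshorne1977, II Ex. 6.8 and II §6 (p. 143)] -/
theorem CechPic.pullback_eq_one_of_isLocalRing {R : CommRingCat.{u}} [IsLocalRing R] (f : Spec R ⟶ X) (a : CechPic X) :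
    CechPic.pullback f a = 1 :=
  CechPic.eq_one_of_isLocalRing _

end Literature.AlgebraicGeometry.Modules

end
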